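/-
Copyright (c) 2026 the pub-hodgecm-mathlib formalisation cell (harness21).  Prover seat hodgecm-mathlib-LH4-p08 (g4), Track A «(D-RAM) FOUR-FRAME», unit U2H, the census leaf
(ρ2b′-X) `stub_U2H_fixedPointCensus_typeTwo_unit0` — dealer LH4-plan (g12) WORD #16∕#21 hand T5a «TORIC LEVEL CENSUS, K-UNRAMIFIED» (payer LH4-p14; plan owner LH4-p12 (g4)):
the u-FREE LEVEL TABLE of the ANISOTROPIC side in CLOSED FORM over the ★ DEFS leaf `levelSet`.  2026-09-04.
-/
import Summits.HodgeConjecture.HodgeConjecture.Theorems.F0P3cDyRamToricCensusDefs   -- ★ p857239 (LH4-p12 (g4)): `IsOrd`, `dualGen`, `levelSet`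
import Literature.NumberTheory.LocalFields.QuadraticOrderLevelClasses              -- ★ p857397 (this seat, D1): membership lemmas, generator sets as translates
import Literature.NumberTheory.LocalFields.QuadraticOrderTorusIndices               -- ★ p857326∕p857349 (this seat): Flicker `[U_M : 𝒪_jˣ] = (q+1)q^{j−1}`
import Literature.NumberTheory.LocalFields.WildQuadraticDatumNormOneQuotient        -- ★ `v_div_map_sub_one_eq_of_v_eq_v_varpi` (depth `d − 1` of `ϖ`-quotients)
import HarnessLib

/-!
# T5a (type U, K-unramified): the u-free level table of the ANISOTROPIC side, closed form in `(q, d)`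

Same frame as the hyperbolic sheet (one-field currency for `M`, third field `K'` with datum `(σ', π', d)` embedded by `jK` onto the Θ-fixed
elements, unit-norm surjectivity `hnorm`).  For an ANISOTROPIC hermitian scalar `h` (no isotropic vector):

  `#levelSet(j,a) = |G_j|` if (`d ≤ j + 1` and `a + d = j + 1`) or (`j + 1 < d`, `a = 0`, `j + d` odd);   `= 0` otherwise,

`|G_j| = (q+1)q^{j−1}` (`j ≥ 1`), `1` (`j = 0`).  MECHANISM: (A1) anisotropy forces the PARITY `v(h) = exp(2n + 1 − d)` (else the skew unit `ι·w∕h'`,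
`ι = π' − σ'π'`, is a unit norm `N_Θ(ω)` by `hnorm` and `ω` is isotropic); (A2) for `g ∈ K'` of that parity `|g + σ'g| = |g|·|π'|^{d−1}` (★ depth `d − 1` of
`π'`-quotients); hence (A3) the twist depth `|1 + η·t(ω)| = exp(1 − d)` is THE SAME for every unit `ω`, so by ★ D1's membership lemmas the generators of
level `a` are all of `ϖE^{k₀}·U_M` or none, and `#(U_M ∕ 𝒪_jˣ) = |G_j|` (★ Flicker).
HONEST LABEL: HC_CM is proved only modulo the 7 printed citations (2 remaining named inputs: hLiu418 = stmt-HodgeConjecture-24832,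
h413 = stmt-HodgeConjecture-24833) until rung 0 closes; (ρ2b′-X) :418 is an OPEN prover target — this file is a helper (`--supports`), proofs only.
-/

set_option autoImplicit false

open WithZero IsLocalRing
open scoped Valued Pointwise

namespace Summit.HodgeConjecture.HodgeConjecture.Cruxes.H413.F0P3cDyRamToricLevelCensusUnr

open Summit.HodgeConjecture.HodgeConjecture.Cruxes.H413.F0P3cDyRamToricCensusDefs
open Literature.NumberTheory.LocalFields.QuadraticOrder Literature.NumberTheory.LocalFields.WildQuadraticDatum

variable {K : Type*} [Field K] [Valued K ℤᵐ⁰] {ρ Θ : K →+* K} {α ϖE h : K} {d q : ℕ}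
variable {K' : Type*} [Field K'] [Valued K' ℤᵐ⁰] {σ' : K' →+* K'} {π' : K'}

/-! ## §1 The third-field lemma: elements of the «other parity» have trace-depth exactly `d − 1` -/

/-- **(A2) DEPTH `d − 1` ON THE ODD COSET.**  In the ramified datum (`σ'` involution and isometry, fixed elements of even `log v`, `|π'| = exp(−1)`,
`|π' − σ'π'| = |π'|^d`, `1 ≤ d`): if `|g| = exp(2n + 1 − d)` then `|g + σ'g| = |g|·exp(1 − d)` EXACTLY (`g = ι·a·w` with `ι = π' − σ'π'` skew, `w` fixed,
`|a| = |π'|`, and `|a∕σ'a − 1| = |π'|^{d−1}`). [cite: Serre1979, Ch. V §3] -/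
theorem v_add_map_eq_of_parity (hσ' : ∀ x, σ' (σ' x) = x) (hvσ' : ∀ x, Valued.v (σ' x) = Valued.v x)
    (hfix' : ∀ x : K', σ' x = x → x ≠ 0 → ∃ n : ℤ, Valued.v x = exp (2 * n)) (hπ' : Valued.v π' = exp (-1 : ℤ))
    (hdd' : Valued.v (π' - σ' π') = Valued.v π' ^ d) (hd : 1 ≤ d) {g : K'} {n : ℤ} (hg : Valued.v g = exp (2 * n + 1 - d)) :
    Valued.v (g + σ' g) = Valued.v g * exp (1 - (d : ℤ)) := by
  have hπ0 : π' ≠ 0 := fun h0 => by rw [h0, map_zero] at hπ'; exact (exp_ne_zero hπ'.symm).elim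
  have hvι : Valued.v (π' - σ' π') = exp (-(d : ℤ)) := by rw [hdd', hπ', ← exp_nsmul, nsmul_eq_mul, mul_neg, mul_one]
  have hι0 : π' - σ' π' ≠ 0 := fun h0 => by rw [h0, map_zero] at hvι; exact (exp_ne_zero hvι.symm).elim
  have hσι : σ' (π' - σ' π') = -(π' - σ' π') := by rw [map_sub, hσ', neg_sub]
  have hg0 : g ≠ 0 := fun h0 => by rw [h0, map_zero] at hg; exact (exp_ne_zero hg.symm).elim
  have hσg0 : σ' g ≠ 0 := (map_ne_zero σ').2 hg0
  -- the fixed normaliser `w = (π'σ'π')^{n+1}` and `a := g ∕ ι · w` with `|a| = |π'|`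
  have hN0 : π' * σ' π' ≠ 0 := mul_ne_zero hπ0 ((map_ne_zero σ').2 hπ0)
  have hσN : σ' (π' * σ' π') = π' * σ' π' := by rw [map_mul, hσ', mul_comm]
  have hvN : Valued.v (π' * σ' π') = exp (-2 : ℤ) := by
    rw [map_mul, hvσ', hπ', ← exp_add]; congr 1
  set w : K' := (π' * σ' π') ^ (n + 1) with hw
  have hσw : σ' w = w := by rw [hw, map_zpow₀, hσN]
  have hw0 : w ≠ 0 := zpow_ne_zero _ hN0
  have hvw : Valued.v w = exp (-2 * (n + 1)) := by rw [hw, map_zpow₀, hvN, ← exp_zsmul, smul_eq_mul]; congr 1; ring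
  set a : K' := g / (π' - σ' π') * w with ha
  have hva : Valued.v a = Valued.v π' := by
    rw [ha, map_mul, map_div₀, hg, hvι, hvw, hπ', ← exp_sub, ← exp_add]; congr 1; ring
  have hdepth := v_div_map_sub_one_eq_of_v_eq_v_varpi hσ' hvσ' hfix' hπ' hdd' hd hva
  -- `a ∕ σ'a = −g ∕ σ'g`, so `a∕σ'a − 1 = −(g + σ'g)∕σ'g`
  have hσa : σ' a = -(σ' g / (π' - σ' π') * w) := by
    rw [ha, map_mul, map_div₀, hσι, hσw, div_neg, neg_mul]
  have hquot : a / σ' a - 1 = -((g + σ' g) / σ' g) := by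
    rw [hσa, ha]
    field_simp
    ring
  rw [hquot, Valuation.map_neg, map_div₀, hvσ', hπ', ← exp_nsmul, nsmul_eq_mul] at hdepth
  rw [div_eq_iff ((Valuation.ne_zero_iff _).2 hg0)] at hdepth
  rw [hdepth, mul_comm]; congr 2; omega


/-! ## §2 Anisotropy ⟺ the other parity of `v(h)`; the twist depth is then CONSTANT `exp(1 − d)` -/

/-- **(A1) PARITY OF AN ANISOTROPIC SCALAR**: if `h ∈ K♮ˣ` admits NO isotropic vector (`h·Θx·x` is never ρ-skew for `x ≠ 0`), then `|h| = exp(2n + 1 − d)`.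
Otherwise `|h| = exp(2n − d)`, the skew UNIT `z = jK(ι·w∕h')` (`ι = π' − σ'π'`, `w = (π'σ'π')^{−n}`) is Θ-fixed, hence a unit norm `N_Θ(ω)` (`hnorm`),
and `ω` is isotropic. [cite: Serre1979, Ch. V §2] [cite: Jacobowitz1962, §4] -/
theorem exists_v_eq_exp_of_aniso (hΘh : Θ h = h) (hh : h ≠ 0)
    (hσ' : ∀ x, σ' (σ' x) = x) (hvσ' : ∀ x, Valued.v (σ' x) = Valued.v x) (hπ' : Valued.v π' = exp (-1 : ℤ))
    (hdd' : Valued.v (π' - σ' π') = Valued.v π' ^ d) (jK : K' →+* K) (hjv : ∀ x, Valued.v (jK x) = Valued.v x) (hjΘ : ∀ x, Θ (jK x) = jK x)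
    (hjfix : ∀ z : K, Θ z = z → ∃ x, jK x = z) (hjσ : ∀ x, jK (σ' x) = ρ (jK x))
    (hnorm : ∀ z : Kˣ, Θ (z : K) = z → Valued.v (z : K) = 1 → ∃ ω : Kˣ, Valued.v (ω : K) = 1 ∧ (ω : K) * Θ ω = z)
    (haniso : ¬ ∃ x : K, x ≠ 0 ∧ h * Θ x * x + ρ (h * Θ x * x) = 0) :
    ∃ n : ℤ, Valued.v h = exp (2 * n + 1 - d) := by
  have hπ0 : π' ≠ 0 := fun h0 => by rw [h0, map_zero] at hπ'; exact (exp_ne_zero hπ'.symm).elim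
  have hvι : Valued.v (π' - σ' π') = exp (-(d : ℤ)) := by rw [hdd', hπ', ← exp_nsmul, nsmul_eq_mul, mul_neg, mul_one]
  have hι0 : π' - σ' π' ≠ 0 := fun h0 => by rw [h0, map_zero] at hvι; exact (exp_ne_zero hvι.symm).elim
  have hσι : σ' (π' - σ' π') = -(π' - σ' π') := by rw [map_sub, hσ', neg_sub]
  have hN0 : π' * σ' π' ≠ 0 := mul_ne_zero hπ0 ((map_ne_zero σ').2 hπ0)
  have hσN : σ' (π' * σ' π') = π' * σ' π' := by rw [map_mul, hσ', mul_comm]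
  have hvN : Valued.v (π' * σ' π') = exp (-2 : ℤ) := by
    rw [map_mul, hvσ', hπ', ← exp_add]; congr 1
  obtain ⟨h', hh'⟩ := hjfix h hΘh
  have hh'0 : h' ≠ 0 := by rintro rfl; exact hh (by rw [← hh', map_zero])
  obtain ⟨e, he⟩ : ∃ e : ℤ, Valued.v h' = exp e := ⟨_, (exp_log ((Valuation.ne_zero_iff _).2 hh'0)).symm⟩
  rcases Int.even_or_odd' (e + d) with ⟨n, hn | hn⟩
  · -- `|h| = exp(2n − d)`: an isotropic vector exists
    exfalso
    set w : K' := (π' * σ' π') ^ (-n) with hw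
    have hσw : σ' w = w := by rw [hw, map_zpow₀, hσN]
    have hw0 : w ≠ 0 := zpow_ne_zero _ hN0
    have hvw : Valued.v w = exp (2 * n) := by rw [hw, map_zpow₀, hvN, ← exp_zsmul, smul_eq_mul]; congr 1; ring
    set z' : K' := (π' - σ' π') / h' * w with hz'
    have hvz' : Valued.v z' = 1 := by
      rw [hz', map_mul, map_div₀, hvι, he, hvw, ← exp_sub, ← exp_add, ← exp_zero]; congr 1; omega
    have hz'0 : z' ≠ 0 := fun h0 => by rw [h0, map_zero] at hvz'; exact zero_ne_one hvz'
    have hz0 : jK z' ≠ 0 := (map_ne_zero jK).2 hz'0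
    have hhz : h * jK z' = jK ((π' - σ' π') * w) := by
      rw [← hh', ← map_mul]; congr 1; rw [hz']; field_simp
    have hρhz : ρ (h * jK z') = -(h * jK z') := by
      rw [hhz, ← hjσ, map_mul, hσι, hσw, neg_mul, map_neg]
    obtain ⟨ω, -, hωz⟩ := hnorm (Units.mk0 (jK z') hz0) (by rw [Units.val_mk0, hjΘ]) (by rw [Units.val_mk0, hjv, hvz'])
    rw [Units.val_mk0] at hωz
    refine haniso ⟨(ω : K), ω.ne_zero, ?_⟩
    rw [mul_assoc, mul_comm (Θ (ω : K)) ω, hωz, hρhz, add_neg_cancel]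
  · exact ⟨n, by rw [← hh', hjv, he]; congr 1; omega⟩

/-- **(A3) CONSTANCY OF THE TWIST DEPTH ON THE ANISOTROPIC SIDE**: if `|h| = exp(2n + 1 − d)` (`h ∈ K♮ˣ`), then for EVERY unit `ω` of `M`,
`|1 + (ρh∕h)·(ρN∕N)| = exp(1 − d)` with `N = ω·Θω` — the whole of `G_j` sits at the single depth `d − 1`. [cite: Serre1979, Ch. V §3] [cite: Jacobowitz1962, §4] -/
theorem v_one_add_twist_eq_of_parity (hΘΘ : ∀ x, Θ (Θ x) = x) (hvΘ : ∀ x, Valued.v (Θ x) = Valued.v x) (hΘh : Θ h = h) (hh : h ≠ 0)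
    (hσ' : ∀ x, σ' (σ' x) = x) (hvσ' : ∀ x, Valued.v (σ' x) = Valued.v x)
    (hfix' : ∀ x : K', σ' x = x → x ≠ 0 → ∃ n : ℤ, Valued.v x = exp (2 * n)) (hπ' : Valued.v π' = exp (-1 : ℤ))
    (hdd' : Valued.v (π' - σ' π') = Valued.v π' ^ d) (hd : 1 ≤ d) (jK : K' →+* K) (hjv : ∀ x, Valued.v (jK x) = Valued.v x)
    (hjfix : ∀ z : K, Θ z = z → ∃ x, jK x = z) (hjσ : ∀ x, jK (σ' x) = ρ (jK x))
    {n : ℤ} (hvh : Valued.v h = exp (2 * n + 1 - d)) (ω : Kˣ) (hω : Valued.v (ω : K) = 1) :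
    Valued.v (1 + ρ h / h * (ρ ((ω : K) * Θ ω) / ((ω : K) * Θ ω))) = exp (1 - (d : ℤ)) := by
  have hN0 : (ω : K) * Θ ω ≠ 0 := mul_ne_zero ω.ne_zero ((map_ne_zero Θ).2 ω.ne_zero)
  have hNΘ : Θ ((ω : K) * Θ ω) = (ω : K) * Θ ω := by rw [map_mul, hΘΘ, mul_comm]
  have hvN : Valued.v ((ω : K) * Θ ω) = 1 := by rw [map_mul, hvΘ, hω, mul_one]
  obtain ⟨h', hh'⟩ := hjfix h hΘh
  obtain ⟨n', hn'⟩ := hjfix _ hNΘ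
  have hh'0 : h' ≠ 0 := by rintro rfl; exact hh (by rw [← hh', map_zero])
  have hn'0 : n' ≠ 0 := by rintro rfl; exact hN0 (by rw [← hn', map_zero])
  have hg : Valued.v (h' * n') = exp (2 * n + 1 - d) := by
    rw [map_mul, ← hjv, ← hjv, hh', hn', hvh, hvN, mul_one]
  have hsum := v_add_map_eq_of_parity hσ' hvσ' hfix' hπ' hdd' hd hg
  have hg0 : jK (h' * n') ≠ 0 := (map_ne_zero jK).2 (mul_ne_zero hh'0 hn'0)
  have hexpr : 1 + ρ h / h * (ρ ((ω : K) * Θ ω) / ((ω : K) * Θ ω)) = jK (h' * n' + σ' (h' * n')) / jK (h' * n') := by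
    rw [← hh', ← hn', ← hjσ, ← hjσ, div_mul_div_comm, ← map_mul jK, ← map_mul jK, ← map_mul σ', one_add_div hg0, ← map_add]
  rw [hexpr, map_div₀, hjv, hjv, hsum, hg, mul_div_cancel_left₀ _ exp_ne_zero]

/-! ## §3 The count -/

/-- **LATTICES ↔ GENERATOR CLASSES for the ★ DEFS level set**: `#levelSet(j,a) = #(mk_{𝒪_jˣ} '' {x₀ ∈ Mˣ : integral ∧ Gram-primitive ∧ level a})`
(★ F1 `ncard_setOf_orderLattice_eq_ncard_image_mk`, `|ϖE|^a = exp(−a)`). [cite: Jacobowitz1962, §4] -/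
theorem ncard_levelSet_eq_ncard_image_mk (hvρ : ∀ x, Valued.v (ρ x) = Valued.v x) (hϖE : Valued.v ϖE = exp (-1 : ℤ))
    {H : Subgroup Kˣ} (j a : ℕ)
    (hH : ∀ u : Kˣ, u ∈ H ↔ Valued.v (u : K) = 1 ∧ Valued.v ((u : K) - ρ u) ≤ Valued.v (ϖE ^ j * (α - ρ α))) :
    (levelSet ρ Θ α ϖE h j a).ncard =
      ((QuotientGroup.mk : Kˣ → Kˣ ⧸ H) '' {x₀ : Kˣ |
        ((Valued.v (h * ((x₀ : K) * Θ x₀) * (ϖE ^ j * (α - ρ α))) ≤ 1 ∧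
              Valued.v (h * ((x₀ : K) * Θ x₀) * (ϖE ^ j * (α - ρ α)) - ρ (h * ((x₀ : K) * Θ x₀) * (ϖE ^ j * (α - ρ α)))) ≤ Valued.v (ϖE ^ j * (α - ρ α))) ∧
            ¬ (Valued.v (h * ((x₀ : K) * Θ x₀) * (ϖE ^ j * (α - ρ α)) / ϖE) ≤ 1 ∧
                Valued.v (h * ((x₀ : K) * Θ x₀) * (ϖE ^ j * (α - ρ α)) / ϖE - ρ (h * ((x₀ : K) * Θ x₀) * (ϖE ^ j * (α - ρ α)) / ϖE)) ≤
                  Valued.v (ϖE ^ j * (α - ρ α)))) ∧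
          Valued.v (h * ((x₀ : K) * Θ x₀) * (ϖE ^ j * (α - ρ α))) = exp (-(a : ℤ))}).ncard := by
  have hϖa : Valued.v ϖE ^ a = exp (-(a : ℤ)) := by rw [hϖE, ← exp_nsmul, nsmul_eq_mul, mul_neg, mul_one]
  rw [← ncard_setOf_orderLattice_eq_ncard_image_mk hvρ hH]
  congr 1
  ext Λ
  simp only [levelSet, Set.mem_setOf_eq, IsOrd, dualGen, hϖa]
  constructor
  · rintro ⟨x₀, hx₀, hmem, hP1, hP2, hP3⟩; exact ⟨Units.mk0 x₀ hx₀, ⟨⟨hP1, hP2⟩, hP3⟩, hmem⟩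
  · rintro ⟨x₀, ⟨⟨hP1, hP2⟩, hP3⟩, hmem⟩; exact ⟨(x₀ : K), x₀.ne_zero, hmem, hP1, hP2, hP3⟩

/-- **(UNR, ANISOTROPIC) — THE u-FREE LEVEL TABLE OF THE ANISOTROPIC SIDE, CLOSED FORM.**  For the M∕E-unramified frame (one-field currency) with
third field `K'` (datum `(σ', π', d)`, embedded by `jK` onto the Θ-fixed elements), unit-norm surjectivity `hnorm`, residue field of `M` of size `q²`,
and an ANISOTROPIC hermitian scalar `h` (no isotropic vector):
`#levelSet(j,a) = |G_j|` iff (`d ≤ j + 1` ∧ `a + d = j + 1`) ∨ (`j + 1 < d` ∧ `a = 0` ∧ `j + d` odd), else `0` (`|G_j| = (q+1)q^{j−1}`, `|G_0| = 1`).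
[cite: Flicker1998UnitaryFL, p. 84] [cite: Serre1979, Ch. V §3] [cite: Jacobowitz1962, §4] -/
theorem ncard_levelSet_unr_aniso
    (hρρ : ∀ x, ρ (ρ x) = x) (hvρ : ∀ x, Valued.v (ρ x) = Valued.v x) (hΘΘ : ∀ x, Θ (Θ x) = x) (hΘρ : ∀ x, Θ (ρ x) = ρ (Θ x))
    (hvΘ : ∀ x, Valued.v (Θ x) = Valued.v x) (hα1 : Valued.v α ≤ 1) (hα : Valued.v (α - ρ α) = 1)
    (hρϖE : ρ ϖE = ϖE) (hϖE : Valued.v ϖE = exp (-1 : ℤ)) (hΘh : Θ h = h) (hh : h ≠ 0)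
    [IsDiscreteValuationRing 𝒪[K]] [Finite 𝓀[K]] (hq : Nat.card 𝓀[K] = q ^ 2)
    (hσ' : ∀ x, σ' (σ' x) = x) (hvσ' : ∀ x, Valued.v (σ' x) = Valued.v x) (hfix' : ∀ x : K', σ' x = x → x ≠ 0 → ∃ n : ℤ, Valued.v x = exp (2 * n))
    (hπ' : Valued.v π' = exp (-1 : ℤ)) (hdd' : Valued.v (π' - σ' π') = Valued.v π' ^ d) (hd : 1 ≤ d)
    (jK : K' →+* K) (hjv : ∀ x, Valued.v (jK x) = Valued.v x) (hjΘ : ∀ x, Θ (jK x) = jK x)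
    (hjfix : ∀ z : K, Θ z = z → ∃ x, jK x = z) (hjσ : ∀ x, jK (σ' x) = ρ (jK x))
    (hnorm : ∀ z : Kˣ, Θ (z : K) = z → Valued.v (z : K) = 1 → ∃ ω : Kˣ, Valued.v (ω : K) = 1 ∧ (ω : K) * Θ ω = z)
    (haniso : ¬ ∃ x : K, x ≠ 0 ∧ h * Θ x * x + ρ (h * Θ x * x) = 0) (j a : ℕ) :
    (levelSet ρ Θ α ϖE h j a).ncard =
      if (d ≤ j + 1 ∧ a + d = j + 1) ∨ (j + 1 < d ∧ a = 0 ∧ (j + d) % 2 = 1) then (if j = 0 then 1 else (q + 1) * q ^ (j - 1)) else 0 := by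
  classical
  have hϖ0 : ϖE ≠ 0 := (v_varpi_zpow hϖE 0).1
  -- (1) parity and constancy
  obtain ⟨n, hvh⟩ := exists_v_eq_exp_of_aniso hΘh hh hσ' hvσ' hπ' hdd' jK hjv hjΘ hjfix hjσ hnorm haniso
  have hvh' : Valued.v h = exp (-((d : ℤ) - 2 * n - 1)) := by rw [hvh]; congr 1; ring
  have hconst := v_one_add_twist_eq_of_parity hΘΘ hvΘ hΘh hh hσ' hvσ' hfix' hπ' hdd' hd jK hjv hjfix hjσ hvh
  -- (2) units and order units, `[U : 𝒪_jˣ] = |G_j|`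
  obtain ⟨U, hU⟩ := exists_subgroup_v_eq_one (K := K)
  obtain ⟨H, hH⟩ := exists_subgroup_orderUnits (ρ := ρ) (α := α) hvρ (ϖE ^ j)
  have hvc : Valued.v (ϖE ^ j * (α - ρ α)) = exp (-(j : ℤ)) := by
    rw [map_mul, hα, mul_one, map_pow, hϖE, ← exp_nsmul, nsmul_eq_mul, mul_neg, mul_one]
  have hHrel : H.relIndex U = if j = 0 then 1 else (q + 1) * q ^ (j - 1) := by
    split_ifs with hj0
    · subst hj0
      rw [Subgroup.relIndex_eq_one]
      intro u hu
      rw [hH]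
      refine ⟨(hU u).1 hu, ?_⟩
      rw [hvc]
      refine (Valuation.map_sub _ _ _).trans ?_
      rw [hvρ, (hU u).1 hu, max_self]; norm_num
    · have hH' : ∀ u, u ∈ H ↔ Valued.v (u : K) = 1 ∧ Valued.v ((u : K) - ρ u) ≤ Valued.v (ϖE ^ j) := fun u => by
        rw [hH u, map_mul Valued.v (ϖE ^ j), hα, mul_one]
      exact relIndex_orderUnits_eq_of_unramified hρρ hvρ hα1 hα hϖE hq (Nat.one_le_iff_ne_zero.2 hj0) U H hU hH'
  have hUcount : ((QuotientGroup.mk : Kˣ → Kˣ ⧸ H) '' (U : Set Kˣ)).ncard = if j = 0 then 1 else (q + 1) * q ^ (j - 1) := by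
    rw [← hHrel, ← ncard_image_mk_smul_subgroup H U 1, one_smul]
  -- (3) lattices ↔ generator classes, then the three cases
  rw [ncard_levelSet_eq_ncard_image_mk hvρ hϖE j a hH]
  by_cases hpar : (j + a + d) % 2 = 1
  swap
  · rw [setOf_levelGen_eq_empty_of_odd (ρ := ρ) (Θ := Θ) hvΘ hα hϖE hvh' j a (fun k hk => by omega), Set.image_empty,
      Set.ncard_empty, if_neg (by omega)]
  by_cases ha0 : a = 0
  · subst ha0
    rw [setOf_levelGen_eq_smul_zero hρρ hΘρ hvΘ hα hϖE hρϖE hϖ0 hh hvh' j (k₀ := n - ((j + d - 1) / 2 : ℕ)) (by push_cast; omega),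
      ncard_image_mk_smul]
    by_cases hjd : j + 1 ≤ d
    · have hS : {ω : Kˣ | Valued.v (ω : K) = 1 ∧ Valued.v (1 + ρ h / h * (ρ ((ω : K) * Θ ω) / ((ω : K) * Θ ω))) ≤ exp (-(j : ℤ))} =
          (U : Set Kˣ) := by
        ext ω
        simp only [Set.mem_setOf_eq, SetLike.mem_coe, hU]
        exact ⟨fun h1 => h1.1, fun h1 => ⟨h1, by rw [hconst ω h1, exp_le_exp]; omega⟩⟩
      rw [hS, hUcount]
      exact (if_pos (by omega)).symm
    · have hS : {ω : Kˣ | Valued.v (ω : K) = 1 ∧ Valued.v (1 + ρ h / h * (ρ ((ω : K) * Θ ω) / ((ω : K) * Θ ω))) ≤ exp (-(j : ℤ))} = ∅ := by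
        ext ω
        simp only [Set.mem_setOf_eq, Set.mem_empty_iff_false, iff_false, not_and]
        intro h1
        rw [hconst ω h1, exp_le_exp]; omega
      rw [hS, Set.image_empty, Set.ncard_empty, if_neg (by omega)]
  · have ha1 : 1 ≤ a := Nat.one_le_iff_ne_zero.2 ha0
    rw [setOf_levelGen_eq_smul_of_pos hρρ hΘρ hvΘ hα hϖE hρϖE hϖ0 hh hvh' j ha1 (k₀ := n + ((a : ℤ) - j - d + 1) / 2) (by omega),
      ncard_image_mk_smul]
    by_cases hjd : a + d = j + 1
    · have hS : {ω : Kˣ | Valued.v (ω : K) = 1 ∧ Valued.v (1 + ρ h / h * (ρ ((ω : K) * Θ ω) / ((ω : K) * Θ ω))) = exp ((a : ℤ) - j)} =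
          (U : Set Kˣ) := by
        ext ω
        simp only [Set.mem_setOf_eq, SetLike.mem_coe, hU]
        exact ⟨fun h1 => h1.1, fun h1 => ⟨h1, by rw [hconst ω h1]; congr 1; omega⟩⟩
      rw [hS, hUcount]
      exact (if_pos (by omega)).symm
    · have hS : {ω : Kˣ | Valued.v (ω : K) = 1 ∧ Valued.v (1 + ρ h / h * (ρ ((ω : K) * Θ ω) / ((ω : K) * Θ ω))) = exp ((a : ℤ) - j)} = ∅ := by
        ext ω
        simp only [Set.mem_setOf_eq, Set.mem_empty_iff_false, iff_false, not_and]
        intro h1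
        rw [hconst ω h1, exp_inj]; omega
      rw [hS, Set.image_empty, Set.ncard_empty, if_neg (by omega)]

end Summit.HodgeConjecture.HodgeConjecture.Cruxes.H413.F0P3cDyRamToricLevelCensusUnr
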